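import Summits.ValiantsHypothesis.ValiantsHypothesis.Theses.LacunarySymmetroid
import Summits.ValiantsHypothesis.ValiantsHypothesis.Theorems.MatrixDescartes.Negative.MatrixDescartesSymmetryFree
import Summits.ValiantsHypothesis.ValiantsHypothesis.Theorems.SymmetroidPencilBasics

/-!
# `MatrixDescartes` — negative lemma modulo `TropicalMonster` (Viro patchworking of parametric assignment designs)

Crux `stmt-ValiantsHypothesis-18050` (`Theses.LacunarySymmetroid.MatrixDescartes`, MDR).  This file makes
the TROPICAL door to a refutation a kernel theorem:

  `MatrixDescartes_false_of_TropicalMonster : TropicalMonster → ¬ MatrixDescartes`.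

A *tropical design* in the format `(m, K)` is: exponents `d : Fin K → ℕ`, integer valuations
`v i j l` and signs `ε i j l ∈ {−1, 0, 1}` for every entry `(i, j)` and class `l`.  Its patchworked
real pencil at base `b` has coefficient matrices `(T l) i j = ε i j l · b^{−v i j l}`.  Expanding
`det (∑ₗ x^{dₗ} Tₗ)` at `x = b^θ` (`θ ∈ ℤ`) by Leibniz and distributivity gives a signed sum of
`m!·K^m` monomials `± b^{w}` indexed by (permutation `σ`, row-to-class map `λ`), with tropical weight
`w = θ·∑ᵢ d(λ i) − ∑ᵢ v (σ i) i (λ i)` — the value at slope `θ` of the K-CLASS PARAMETRIC ASSIGNMENT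
underlying the design.  If at `θ` one term is the unique optimum (all other non-vanishing terms have
strictly smaller, hence by integrality `≤ w − 1`, weight) and `b > m!·K^m`, that term decides the sign
of the determinant (`det_patch_sign`).  Hence `B + 1` integer slopes with unique optima of ALTERNATING
signs give `B` distinct positive zeros (`le_card_posRoots_of_alternating`, tree), for a general real
pencil of the same format; MDR is symmetry-free (`matrixDescartesGeneral_of_matrixDescartes`, tree), so a
family of such designs with `B^q > 2^{K⌊log₂K⌋}` at `m ≤ 2^{(⌊log₂K⌋+c)^c}` for infinitely many `K`
(`TropicalMonster`) refutes the crux.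

`TropicalMonster` is a statement of finite combinatorics (2-D shadows of Birkhoff polytopes along `K`
slope classes, cf. Hrubeš–Yehudayoff 2021 Open Problem 1 and the sibling item `DivisionGap.ShadowBirkhoff`):
it is NOT claimed here; the item stays open and `TropicalMonster` is the construction target.
Quantitative remark (docstring of `TropicalMonster`): since `m` may be quasi-polynomial in `K`, designs
with `B ≥ m^{δK} / K^{O(K)}` breakpoints on `m ≥ poly(K)` nodes already suffice (`log m = log²K`).

[folklore] Viro patchworking / dominance for determinants; parametric assignment = tropical determinant.
-/

-- `Summit.ValiantsHypothesis.ValiantsHypothesis.…` repeats a component by the D-0017 layout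
-- (single-conjunct summit), which the `dupNamespace` linter flags; the name is mandated.
set_option linter.dupNamespace false

namespace Summit.ValiantsHypothesis.ValiantsHypothesis.Theorems.MatrixDescartes.Negative

open Summit.ValiantsHypothesis.ValiantsHypothesis.Theses.LacunarySymmetroid
open scoped BigOperators Matrix
open Polynomial Finset

section Design

variable {m K : ℕ}

/-- The patchworked real coefficient matrices of a tropical design at base `b`:
`(T l) i j = ε i j l · b ^ (− v i j l)`. -/
noncomputable def patchMatrix (b : ℝ) (v ε : Fin m → Fin m → Fin K → ℤ) (l : Fin K) :
    Matrix (Fin m) (Fin m) ℝ :=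
  fun i j => (ε i j l : ℝ) * b ^ (-(v i j l))

/-- Tropical weight of the Leibniz term `(σ, λ)` at the integer slope `θ`:
`θ · ∑ᵢ d (λ i) − ∑ᵢ v (σ i) i (λ i)` (the objective of the K-class parametric assignment). -/
def tropWeight (d : Fin K → ℕ) (v : Fin m → Fin m → Fin K → ℤ) (θ : ℤ)
    (p : Equiv.Perm (Fin m) × (Fin m → Fin K)) : ℤ :=
  θ * ∑ i, (d (p.2 i) : ℤ) - ∑ i, v (p.1 i) i (p.2 i)

/-- Sign of the Leibniz term `(σ, λ)`: `sign σ · ∏ᵢ ε (σ i) i (λ i)` (zero iff the term is absent). -/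
def termSign (ε : Fin m → Fin m → Fin K → ℤ) (p : Equiv.Perm (Fin m) × (Fin m → Fin K)) : ℤ :=
  (Equiv.Perm.sign p.1 : ℤ) * ∏ i, ε (p.1 i) i (p.2 i)

/-- `(σ, λ)` is the UNIQUE optimum of the design at slope `θ`: its term is present and every other
present term has strictly smaller tropical weight. -/
def IsDominant (d : Fin K → ℕ) (v ε : Fin m → Fin m → Fin K → ℤ) (θ : ℤ)
    (p : Equiv.Perm (Fin m) × (Fin m → Fin K)) : Prop :=
  termSign ε p ≠ 0 ∧ ∀ p', p' ≠ p → termSign ε p' ≠ 0 → tropWeight d v θ p' < tropWeight d v θ p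

end Design

/-- **`TropicalMonster`** (construction target, NOT claimed): for some fixed `c, q` and infinitely
many `K` there is a tropical design of format `(m, K)` with `m ≤ 2^((⌊log₂K⌋+c)^c)`, signs in
`{−1,0,1}`, and `B + 1` strictly increasing integer slopes `θ₀ < ⋯ < θ_B` at each of which some Leibniz
term `(σₖ, λₖ)` is the unique optimum, with alternating signs `termSign (σₖ,λₖ) · termSign (σₖ₊₁,λₖ₊₁) < 0`,
and `2^(K⌊log₂K⌋) < B^q`.  Equivalently: K-slope-class parametric assignment problems on `m` nodes with
that many sign-alternating breakpoints (2-D shadows of the Birkhoff polytope `B_m` along `K` slope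
classes; Hrubeš–Yehudayoff 2021, Open Problem 1, asks for the unconstrained growth).  Since `m` may be
quasi-polynomial in `K`, `B ≥ m^{δK}/K^{O(K)}` on `m ≥ poly(K)` nodes suffices (`log m = log²K`). -/
def TropicalMonster : Prop :=
  ∃ c q : ℕ, 0 < q ∧ ∀ K₀ : ℕ, ∃ K m : ℕ, K₀ ≤ K ∧ m ≤ 2 ^ ((Nat.log 2 K + c) ^ c) ∧
    ∃ (d : Fin K → ℕ) (v ε : Fin m → Fin m → Fin K → ℤ) (B : ℕ) (θ : Fin (B + 1) → ℤ)
      (p : Fin (B + 1) → Equiv.Perm (Fin m) × (Fin m → Fin K)),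
      (∀ i j l, (ε i j l).natAbs ≤ 1) ∧ StrictMono θ ∧ (∀ k, IsDominant d v ε (θ k) (p k)) ∧
      (∀ k : Fin B, termSign ε (p k.castSucc) * termSign ε (p k.succ) < 0) ∧
      2 ^ (K * Nat.log 2 K) < B ^ q

section Patchworking

variable {m K : ℕ}

/-- `∏ᵢ b^(g i) = b^(∑ᵢ g i)` for integer powers of a nonzero real. [folklore] -/
theorem prod_zpow_eq_zpow_sum_patch {ι : Type*} (s : Finset ι) (g : ι → ℤ) {b : ℝ} (hb : b ≠ 0) :
    ∏ i ∈ s, b ^ g i = b ^ ∑ i ∈ s, g i := by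
  classical
  induction s using Finset.induction_on with
  | empty => simp
  | insert a s ha ih => rw [Finset.prod_insert ha, Finset.sum_insert ha, ih, zpow_add₀ hb]

/-- **Leibniz–patchworking expansion.**  At `x = b^θ` the determinant of the patchworked pencil is the
signed sum of the monomials `termSign · b^{tropWeight}` over all (permutation, row-to-class) pairs. -/
theorem det_patch_eq_sum (b : ℝ) (hb : 0 < b) (d : Fin K → ℕ) (v ε : Fin m → Fin m → Fin K → ℤ)
    (θ : ℤ) :
    (∑ l, (b ^ θ) ^ d l • patchMatrix b v ε l).det =
      ∑ p : Equiv.Perm (Fin m) × (Fin m → Fin K), (termSign ε p : ℝ) * b ^ tropWeight d v θ p := by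
  have hb0 : b ≠ 0 := ne_of_gt hb
  rw [Matrix.det_apply', ← Finset.univ_product_univ, Finset.sum_product]
  refine Finset.sum_congr rfl fun σ _ => ?_
  have hentry : ∀ i, (∑ l, (b ^ θ) ^ d l • patchMatrix b v ε l) (σ i) i
      = ∑ l, (ε (σ i) i l : ℝ) * b ^ (θ * (d l : ℤ) - v (σ i) i l) := by
    intro i
    simp only [Matrix.sum_apply, Matrix.smul_apply, patchMatrix, smul_eq_mul]
    refine Finset.sum_congr rfl fun l _ => ?_
    rw [zpow_sub₀ hb0, zpow_mul, zpow_natCast, zpow_neg, div_eq_mul_inv]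
    ring
  simp_rw [hentry]
  rw [Fintype.prod_sum]
  rw [Finset.mul_sum]
  refine Finset.sum_congr rfl fun f _ => ?_
  rw [Finset.prod_mul_distrib, prod_zpow_eq_zpow_sum_patch _ _ hb0]
  simp only [termSign, tropWeight, Int.cast_mul, Int.cast_prod, Finset.mul_sum, Finset.sum_sub_distrib]
  ring

/-- A sign datum with `|ε| ≤ 1` everywhere gives Leibniz terms of sign `−1, 0` or `1`; in particular
`|termSign| ≤ 1`. -/
theorem abs_termSign_le_one (ε : Fin m → Fin m → Fin K → ℤ) (hε : ∀ i j l, (ε i j l).natAbs ≤ 1)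
    (p : Equiv.Perm (Fin m) × (Fin m → Fin K)) : |(termSign ε p : ℝ)| ≤ 1 := by
  have h1 : |(termSign ε p : ℤ)| ≤ 1 := by
    unfold termSign
    rw [abs_mul, Finset.abs_prod]
    have hs : |((Equiv.Perm.sign p.1 : ℤˣ) : ℤ)| = 1 := by
      rcases Int.units_eq_one_or (Equiv.Perm.sign p.1) with h | h <;> simp [h]
    rw [hs, one_mul]
    calc ∏ i, |ε (p.1 i) i (p.2 i)| ≤ ∏ _i : Fin m, (1 : ℤ) := by
          refine Finset.prod_le_prod (fun i _ => abs_nonneg _) fun i _ => ?_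
          have := hε (p.1 i) i (p.2 i)
          rw [Int.abs_eq_natAbs]
          exact_mod_cast this
      _ = 1 := by simp
  have h2 : |(termSign ε p : ℝ)| = ((|termSign ε p| : ℤ) : ℝ) := (Int.cast_abs).symm
  rw [h2]
  exact_mod_cast h1

/-- A nonzero Leibniz sign is `±1`: its real cast has absolute value `1`. -/
theorem abs_termSign_eq_one (ε : Fin m → Fin m → Fin K → ℤ) (hε : ∀ i j l, (ε i j l).natAbs ≤ 1)
    (p : Equiv.Perm (Fin m) × (Fin m → Fin K)) (hp : termSign ε p ≠ 0) :
    |(termSign ε p : ℝ)| = 1 := by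
  have hle := abs_termSign_le_one ε hε p
  have hz : (1 : ℝ) ≤ |(termSign ε p : ℝ)| := by
    have h1 : (1 : ℤ) ≤ |termSign ε p| := Int.one_le_abs hp
    have h2 : |(termSign ε p : ℝ)| = ((|termSign ε p| : ℤ) : ℝ) := (Int.cast_abs).symm
    rw [h2]
    exact_mod_cast h1
  exact le_antisymm hle hz

/-- **Dominance.**  If `(σ, λ)` is the unique optimum at the integer slope `θ` and the base exceeds the
number `m!·K^m` of Leibniz terms, the determinant of the patchworked pencil at `x = b^θ` has the sign of
the dominant term: `termSign · det > 0`. -/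
theorem det_patch_sign (b : ℝ) (d : Fin K → ℕ) (v ε : Fin m → Fin m → Fin K → ℤ)
    (hε : ∀ i j l, (ε i j l).natAbs ≤ 1) (θ : ℤ) (p : Equiv.Perm (Fin m) × (Fin m → Fin K))
    (hp : IsDominant d v ε θ p)
    (hb : (Fintype.card (Equiv.Perm (Fin m) × (Fin m → Fin K)) : ℝ) < b) :
    0 < (termSign ε p : ℝ) * (∑ l, (b ^ θ) ^ d l • patchMatrix b v ε l).det := by
  classical
  set N : ℕ := Fintype.card (Equiv.Perm (Fin m) × (Fin m → Fin K)) with hN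
  have hN1 : (1 : ℝ) ≤ N := by
    have : 1 ≤ N := Fintype.card_pos_iff.mpr ⟨p⟩
    exact_mod_cast this
  have hb1 : 1 < b := lt_of_le_of_lt hN1 hb
  have hb0 : 0 < b := lt_trans zero_lt_one hb1
  rw [det_patch_eq_sum b hb0 d v ε θ]
  set W := tropWeight d v θ p with hW
  set F : Equiv.Perm (Fin m) × (Fin m → Fin K) → ℝ :=
    fun p' => (termSign ε p' : ℝ) * b ^ tropWeight d v θ p' with hF
  -- split off the dominant term
  rw [← Finset.add_sum_erase _ _ (Finset.mem_univ p)]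
  -- every other term is at most `b^(W-1)` in absolute value
  have hrest : ∀ p' ∈ (Finset.univ.erase p), |F p'| ≤ b ^ (W - 1) := by
    intro p' hp'
    have hne : p' ≠ p := Finset.ne_of_mem_erase hp'
    by_cases hz : termSign ε p' = 0
    · simp only [hF, hz, Int.cast_zero, zero_mul, abs_zero]
      exact le_of_lt (zpow_pos hb0 _)
    · have hlt : tropWeight d v θ p' < W := hp.2 p' hne hz
      have hle : tropWeight d v θ p' ≤ W - 1 := by omega
      simp only [hF, abs_mul, abs_termSign_eq_one ε hε p' hz, one_mul]
      rw [abs_of_pos (zpow_pos hb0 _)]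
      exact zpow_le_zpow_right₀ hb1.le hle
  have hsum : |∑ p' ∈ Finset.univ.erase p, F p'| ≤ ((N : ℝ) - 1) * b ^ (W - 1) := by
    calc |∑ p' ∈ Finset.univ.erase p, F p'| ≤ ∑ p' ∈ Finset.univ.erase p, |F p'| :=
          Finset.abs_sum_le_sum_abs _ _
      _ ≤ ∑ _p' ∈ Finset.univ.erase p, b ^ (W - 1) := Finset.sum_le_sum hrest
      _ = ((N : ℝ) - 1) * b ^ (W - 1) := by
          rw [Finset.sum_const, nsmul_eq_mul, Finset.card_erase_of_mem (Finset.mem_univ p),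
            Finset.card_univ, Nat.cast_sub (Fintype.card_pos_iff.mpr ⟨p⟩), Nat.cast_one]
  have hsmall : |∑ p' ∈ Finset.univ.erase p, F p'| < b ^ W := by
    have h1 : ((N : ℝ) - 1) * b ^ (W - 1) < b * b ^ (W - 1) :=
      mul_lt_mul_of_pos_right (by linarith) (zpow_pos hb0 _)
    have h2 : b * b ^ (W - 1) = b ^ W := by
      rw [mul_comm, ← zpow_add_one₀ (ne_of_gt hb0), sub_add_cancel]
    linarith
  -- the dominant term is `± b^W`
  have hdom : (termSign ε p : ℝ) * F p = b ^ W := by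
    simp only [hF, hW]
    have h1 : (termSign ε p : ℝ) * (termSign ε p : ℝ) = 1 := by
      have := abs_termSign_eq_one ε hε p hp.1
      nlinarith [abs_mul_abs_self (termSign ε p : ℝ), this]
    calc (termSign ε p : ℝ) * ((termSign ε p : ℝ) * b ^ tropWeight d v θ p)
        = ((termSign ε p : ℝ) * (termSign ε p : ℝ)) * b ^ tropWeight d v θ p := by ring
      _ = b ^ tropWeight d v θ p := by rw [h1, one_mul]
  have habs1 : |(termSign ε p : ℝ)| = 1 := abs_termSign_eq_one ε hε p hp.1
  have hcross : |(termSign ε p : ℝ) * ∑ p' ∈ Finset.univ.erase p, F p'| < b ^ W := by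
    rw [abs_mul, habs1, one_mul]
    exact hsmall
  have := neg_abs_le ((termSign ε p : ℝ) * ∑ p' ∈ Finset.univ.erase p, F p')
  rw [mul_add, hdom]
  linarith

/-- Positivity bookkeeping: with alternating dominant signs the determinant changes sign between
consecutive test points `b^{θₖ} < b^{θₖ₊₁}`. -/
theorem det_patch_alternates (b : ℝ) (d : Fin K → ℕ) (v ε : Fin m → Fin m → Fin K → ℤ)
    (hε : ∀ i j l, (ε i j l).natAbs ≤ 1) {B : ℕ} (θ : Fin (B + 1) → ℤ)
    (p : Fin (B + 1) → Equiv.Perm (Fin m) × (Fin m → Fin K))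
    (hdom : ∀ k, IsDominant d v ε (θ k) (p k))
    (halt : ∀ k : Fin B, termSign ε (p k.castSucc) * termSign ε (p k.succ) < 0)
    (hb : (Fintype.card (Equiv.Perm (Fin m) × (Fin m → Fin K)) : ℝ) < b) (k : Fin B) :
    (∑ l, (b ^ θ k.castSucc) ^ d l • patchMatrix b v ε l).det *
      (∑ l, (b ^ θ k.succ) ^ d l • patchMatrix b v ε l).det < 0 := by
  have h1 := det_patch_sign b d v ε hε (θ k.castSucc) (p k.castSucc) (hdom _) hb
  have h2 := det_patch_sign b d v ε hε (θ k.succ) (p k.succ) (hdom _) hb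
  have h3 : ((termSign ε (p k.castSucc) : ℤ) : ℝ) * (termSign ε (p k.succ) : ℝ) < 0 := by
    exact_mod_cast halt k
  -- (s₁ D₁)(s₂ D₂) > 0 and s₁ s₂ < 0 ⇒ D₁ D₂ < 0
  have h4 : 0 < ((termSign ε (p k.castSucc) : ℝ) *
      (∑ l, (b ^ θ k.castSucc) ^ d l • patchMatrix b v ε l).det) *
      ((termSign ε (p k.succ) : ℝ) * (∑ l, (b ^ θ k.succ) ^ d l • patchMatrix b v ε l).det) :=
    mul_pos h1 h2
  set D₁ := (∑ l, (b ^ θ k.castSucc) ^ d l • patchMatrix b v ε l).det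
  set D₂ := (∑ l, (b ^ θ k.succ) ^ d l • patchMatrix b v ε l).det
  set s₁ := (termSign ε (p k.castSucc) : ℝ)
  set s₂ := (termSign ε (p k.succ) : ℝ)
  have h5 : (s₁ * D₁) * (s₂ * D₂) = (s₁ * s₂) * (D₁ * D₂) := by ring
  rw [h5] at h4
  by_contra hcon
  push Not at hcon
  have : (s₁ * s₂) * (D₁ * D₂) ≤ 0 := mul_nonpos_of_nonpos_of_nonneg h3.le hcon
  linarith

/-- **Patchworking.**  A tropical design with `B + 1` unique optima of alternating sign at strictly
increasing integer slopes yields a real pencil of the same format `(m, K)` whose determinant has at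
least `B` distinct positive zeros. -/
theorem le_card_posRoots_patch (d : Fin K → ℕ) (v ε : Fin m → Fin m → Fin K → ℤ)
    (hε : ∀ i j l, (ε i j l).natAbs ≤ 1) {B : ℕ} (θ : Fin (B + 1) → ℤ) (hθ : StrictMono θ)
    (p : Fin (B + 1) → Equiv.Perm (Fin m) × (Fin m → Fin K))
    (hdom : ∀ k, IsDominant d v ε (θ k) (p k))
    (halt : ∀ k : Fin B, termSign ε (p k.castSucc) * termSign ε (p k.succ) < 0) :
    ∃ T : Fin K → Matrix (Fin m) (Fin m) ℝ,
      B ≤ ((∑ l, (X : ℝ[X]) ^ d l • (T l).map Polynomial.C).det.roots.toFinset.filter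
        (fun t => 0 < t)).card := by
  set b : ℝ := (Fintype.card (Equiv.Perm (Fin m) × (Fin m → Fin K)) : ℝ) + 1 with hbdef
  have hb : (Fintype.card (Equiv.Perm (Fin m) × (Fin m → Fin K)) : ℝ) < b := by
    rw [hbdef]; linarith
  have hb1 : 1 < b := by
    have : (1 : ℝ) ≤ Fintype.card (Equiv.Perm (Fin m) × (Fin m → Fin K)) := by
      exact_mod_cast (Fintype.card_pos_iff.mpr ⟨p 0⟩ :
        0 < Fintype.card (Equiv.Perm (Fin m) × (Fin m → Fin K)))
    linarith
  have hb0 : 0 < b := lt_trans zero_lt_one hb1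
  refine ⟨patchMatrix b v ε, ?_⟩
  -- test points `τ k = b^(θ k)`
  let τ : Fin (B + 1) → ℝ := fun k => b ^ θ k
  have hτmono : StrictMono τ := fun i j hij => zpow_lt_zpow_right₀ hb1 (hθ hij)
  have hτpos : ∀ k, 0 < τ k := fun k => zpow_pos hb0 _
  refine Summit.ValiantsHypothesis.ValiantsHypothesis.Theorems.SymmetroidDescartes.le_card_posRoots_of_alternating
    _ B τ hτmono hτpos fun k => ?_
  rw [Summit.ValiantsHypothesis.ValiantsHypothesis.Theorems.SymmetroidDescartes.eval_det_pencil,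
    Summit.ValiantsHypothesis.ValiantsHypothesis.Theorems.SymmetroidDescartes.eval_det_pencil]
  exact det_patch_alternates b d v ε hε θ p hdom halt hb k

end Patchworking


section Sanity

/-- valuations of the smallest sanity design (`m = 1`, `K = 2`): class `0` has valuation `0`,
class `1` valuation `1` (entry `1 − b⁻¹·x`). -/
def v₁₂ : Fin 1 → Fin 1 → Fin 2 → ℤ := fun _ _ l => if l = 1 then 1 else 0

/-- signs of the sanity design: `+` for class `0`, `−` for class `1`. -/
def ε₁₂ : Fin 1 → Fin 1 → Fin 2 → ℤ := fun _ _ l => if l = 1 then -1 else 1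

/-- the two optima of the sanity design: class `0` at slope `0`, class `1` at slope `2`. -/
def p₁₂ : Fin 2 → Equiv.Perm (Fin 1) × (Fin 1 → Fin 2) := fun k => (1, fun _ => k)

/-- **Sanity check (non-vacuity of the patchworking hypotheses).**  The `1 × 1` two-class design
`1 − b⁻¹x` has unique optima of opposite signs at the slopes `0 < 2`, so `le_card_posRoots_patch`
produces a real pencil of format `(1, 2)` with a positive zero (indeed `x = b`). -/
theorem patch_sanity : ∃ T : Fin 2 → Matrix (Fin 1) (Fin 1) ℝ,
    1 ≤ ((∑ l, (X : ℝ[X]) ^ (![0, 1] : Fin 2 → ℕ) l • (T l).map Polynomial.C).det.roots.toFinset.filter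
      (fun t => 0 < t)).card := by
  refine le_card_posRoots_patch ![0, 1] v₁₂ ε₁₂ (by decide) ![0, 2] (by decide) p₁₂ ?_ (by decide)
  intro k
  refine ⟨by fin_cases k <;> decide, fun p' hp' _ => ?_⟩
  -- the only other Leibniz pair uses the other class
  obtain ⟨σ, f⟩ := p'
  have hσ : σ = 1 := Subsingleton.elim _ _
  subst hσ
  have hf : f = fun _ => f 0 := by funext i; rw [Subsingleton.elim i 0]
  fin_cases k
  · have h0 : f 0 = 1 := by
      have : f 0 ≠ 0 := by
        intro h
        apply hp'
        rw [hf, h]; rfl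
      have h2 : ∀ x : Fin 2, x ≠ 0 → x = 1 := by decide
      exact h2 _ this
    rw [hf, h0]
    decide
  · have h0 : f 0 = 0 := by
      have : f 0 ≠ 1 := by
        intro h
        apply hp'
        rw [hf, h]; rfl
      have h2 : ∀ x : Fin 2, x ≠ 1 → x = 0 := by decide
      exact h2 _ this
    rw [hf, h0]
    decide

end Sanity

/-- **The tropical door.**  A `TropicalMonster` refutes the crux `MatrixDescartes`: patchwork each
design into a general real pencil with `Z ≥ B` (so `Z^q ≥ B^q > 2^{K⌊log₂K⌋}`) and use that MDR is
symmetry-free (`matrixDescartesGeneral_of_matrixDescartes`). -/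
theorem MatrixDescartes_false_of_TropicalMonster (hT : TropicalMonster) : ¬ MatrixDescartes := by
  intro hMDR
  have hG := matrixDescartesGeneral_of_matrixDescartes hMDR
  obtain ⟨c, q, hq, hall⟩ := hT
  obtain ⟨K₀, hK₀⟩ := hG c q hq
  obtain ⟨K, m, hK, hm, d, v, ε, B, θ, p, hε, hθ, hdom, halt, hB⟩ := hall K₀
  obtain ⟨T, hBT⟩ := le_card_posRoots_patch d v ε hε θ hθ p hdom halt
  have hZ := hK₀ K m hK hm d T
  have hle : B ≤ ((∑ l, (X : ℝ[X]) ^ d l • (T l).map Polynomial.C).det.roots.toFinset).card :=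
    hBT.trans (Finset.card_filter_le _ _)
  have : B ^ q ≤ 2 ^ (K * Nat.log 2 K) := (Nat.pow_le_pow_left hle q).trans hZ
  omega

end Summit.ValiantsHypothesis.ValiantsHypothesis.Theorems.MatrixDescartes.Negative
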